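import Summits.QuantumFields.YangMills.Theorems.LuscherReductionOneSiteLevelsValleyNearMain
import Summits.QuantumFields.YangMills.Theorems.LuscherReductionOneSiteLevelsValleyRiesz
import Summits.QuantumFields.YangMills.Theorems.LuscherReductionOneSiteLevelsAbsLowerPrep

/-!
# VALLEY, step 4f: the NEAR supersolution bound (Laplace estimate with the transverse-Hessian gain)
# (support module for `stub_absUpperValleyMag` of crux `OneSiteLevels`, route `LuscherReduction`, item stmt-QuantumFields-20007;
# fleet lead prover ym-luscher-20007-p1 g2)

`J_τ(U) = ∫ F_U(W) dW` is split along the kinetic ball `{D(W) ≤ δ'}`.  The TAIL is bounded from a pointwise bound `F_U ≤ e^{6B − BD/2}`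
(true in both shells) by `512 e^{−Bδ'/4} · 𝒢`, `𝒢 = e^{6B}√(π/B)⁹/(2π²)³ ≤ linkCE B/(1 − 27/B)` (`near_tail_le`); the MAIN term is the flat Gaussian
integral of `…ValleyNearMain.near_main_le`, evaluated by the gain lemma `GaussNear.integral_gaussGain_le` with the Riesz data of
`…ValleyRiesz` (`Λ ≥ 2ρ²`).  Result (`valleyJ_le_of_near`): for `δ' ≤ 1/36`, `ε = (9/4)δ' + (½+τ)(2√2√S + 9δ'(2+36δ')) ≤ 1/18` and
`64(½+τ)²ρ²·BS ≤ 100`,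

  `J_τ(U) ≤ 𝒢 · [ (1 + 18ε) e^{BS(9(½+τ)²ρ² + 18δ'(½+τ) − 1)} (1 − (5/16) min((½+τ)(1−36δ')ρ², 1/500)) + 512 e^{−Bδ'/4} ]`.

## WHAT THIS IS NOT
Not the assembled valley estimate; NOT the crux, NOT THE CLAY GAP.  Sorry-free; no new definition, no named fact.
-/

set_option autoImplicit false

noncomputable section

open MeasureTheory Filter Topology Real
open scoped Matrix Quaternion RealInnerProductSpace BigOperators
open Literature.MathematicalPhysics.QuantumFieldTheory
open Literature.MathematicalPhysics.QuantumLattice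
open Literature.Analysis.OperatorTheory.YMMatrixModel

namespace Summit.QuantumFields.YangMills.Theorems.FemtoTransferGap

variable {B τ : ℝ}

/-! ### §1. The tail of the kinetic ball -/

/-- **Tail bound.**  If `F ≤ e^{6B − BD/2}` pointwise (`F ≥ 0` measurable), then
`∫ 1[D > δ'] F ≤ 512 e^{−Bδ'/4} · e^{6B}√(π/B)⁹/(2π²)³`. [folklore] -/
theorem near_tail_le (hB : 0 < B) {δ' : ℝ} {F : Cfg → ℝ} (hFm : Measurable F)
    (hFb : ∃ C : ℝ, ∀ W, |F W| ≤ C)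
    (hF : ∀ W : Cfg, F W ≤ Real.exp (6 * B - B / 2 * ∑ e : Edge 3 1, (2 - 2 * scalarPart (W e)))) :
    ∫ W, {W : Cfg | ∑ e : Edge 3 1, (2 - 2 * scalarPart (W e)) ≤ δ'}ᶜ.indicator F W ∂(configMeasure SU2 1)
      ≤ 512 * Real.exp (-(B * δ' / 4)) * (Real.exp (6 * B) * Real.sqrt (π / B) ^ 9 / (2 * π ^ 2) ^ 3) := by
  set Ω : Set Cfg := {W : Cfg | ∑ e : Edge 3 1, (2 - 2 * scalarPart (W e)) ≤ δ'} with hΩ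
  have hΩm : MeasurableSet Ω := measurableSet_le measurable_sumDefect measurable_const
  have hpt : ∀ W : Cfg, Ωᶜ.indicator F W
      ≤ Real.exp (6 * B) * Real.exp (-(B * δ' / 4)) * Real.exp (-(B / 4 * ∑ e : Edge 3 1, (2 - 2 * scalarPart (W e)))) := by
    intro W
    by_cases hW : W ∈ Ωᶜ
    · rw [Set.indicator_of_mem hW]
      have hD : δ' < ∑ e : Edge 3 1, (2 - 2 * scalarPart (W e)) := by
        have : ¬ (∑ e : Edge 3 1, (2 - 2 * scalarPart (W e)) ≤ δ') := hW
        exact lt_of_not_ge this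
      refine (hF W).trans ?_
      rw [← Real.exp_add, ← Real.exp_add]
      exact Real.exp_le_exp.2 (by nlinarith)
    · rw [Set.indicator_of_notMem hW]; positivity
  obtain ⟨C, hC⟩ := hFb
  have hintL : Integrable (fun W => Ωᶜ.indicator F W) (configMeasure SU2 1) :=
    integrable_configMeasure_of_bounded (hFm.indicator hΩm.compl) ⟨C, abs_indicator_le hC⟩
  have hintR : Integrable (fun W : Cfg => Real.exp (6 * B) * Real.exp (-(B * δ' / 4))
      * Real.exp (-(B / 4 * ∑ e : Edge 3 1, (2 - 2 * scalarPart (W e))))) (configMeasure SU2 1) := by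
    refine integrable_configMeasure_of_bounded (measurable_const.mul (Real.measurable_exp.comp (measurable_const.mul measurable_sumDefect).neg))
      ⟨Real.exp (6 * B) * Real.exp (-(B * δ' / 4)) * 1, fun W => ?_⟩
    rw [abs_of_nonneg (by positivity)]
    refine mul_le_mul_of_nonneg_left ?_ (by positivity)
    rw [Real.exp_le_one_iff, neg_nonpos]
    exact mul_nonneg (by positivity) (sumDefect_nonneg W)
  refine (integral_mono hintL hintR hpt).trans ?_
  rw [integral_const_mul]
  have hkin := integral_exp_neg_mul_sumDefect_le (a := B / 4) (by positivity)
  have hsq : Real.sqrt (π / (B / 4)) ^ 9 = 512 * Real.sqrt (π / B) ^ 9 := by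
    rw [show π / (B / 4) = 2 ^ 2 * (π / B) by field_simp; ring, Real.sqrt_mul (by norm_num), Real.sqrt_sq (by norm_num), mul_pow]
    norm_num
  rw [hsq] at hkin
  have h0 : 0 ≤ Real.exp (6 * B) * Real.exp (-(B * δ' / 4)) := by positivity
  calc Real.exp (6 * B) * Real.exp (-(B * δ' / 4)) * ∫ W, Real.exp (-(B / 4 * ∑ e : Edge 3 1, (2 - 2 * scalarPart (W e)))) ∂configMeasure SU2 1
      ≤ Real.exp (6 * B) * Real.exp (-(B * δ' / 4)) * (512 * Real.sqrt (π / B) ^ 9 / (2 * π ^ 2) ^ 3) := mul_le_mul_of_nonneg_left hkin h0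
    _ = 512 * Real.exp (-(B * δ' / 4)) * (Real.exp (6 * B) * Real.sqrt (π / B) ^ 9 / (2 * π ^ 2) ^ 3) := by ring

/-! ### §2. Scalar numerics -/

/-- `(1/(1−ε))⁹ ≤ 1 + 18ε` for `0 ≤ ε ≤ 1/18` (Bernoulli). [folklore] -/
theorem inv_one_sub_pow_nine_le {ε : ℝ} (hε0 : 0 ≤ ε) (hε : ε ≤ 1 / 18) : (1 / (1 - ε)) ^ 9 ≤ 1 + 18 * ε := by
  have h1 : 0 < 1 - ε := by linarith
  have hb : 1 - 9 * ε ≤ (1 - ε) ^ 9 := by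
    have h := one_add_mul_le_pow (a := -ε) (by linarith) 9
    have e1 : (1 + -ε) = 1 - ε := by ring
    rw [e1] at h
    push_cast at h
    linarith
  rw [div_pow, one_pow, div_le_iff₀ (pow_pos h1 9)]
  nlinarith [mul_le_mul_of_nonneg_left hb (by linarith : (0:ℝ) ≤ 1 + 18 * ε)]

/-- `e^{−1/(32X)} ≤ 1/20000` for `0 < X ≤ 1/500`. [folklore] -/
theorem exp_junk_le {X : ℝ} (hX0 : 0 < X) (hX : X ≤ 1 / 500) : Real.exp (-(1 / (32 * X))) ≤ 1 / 20000 := by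
  have h1 : (125 / 8 : ℝ) ≤ 1 / (32 * X) := by
    rw [le_div_iff₀ (by positivity)]; nlinarith
  have h2 := Real.pow_div_factorial_le_exp (125 / 8 : ℝ) (by norm_num) 6
  have h3 : (20000 : ℝ) ≤ (125 / 8 : ℝ) ^ 6 / (Nat.factorial 6) := by
    rw [show Nat.factorial 6 = 720 by rfl]; norm_num
  have h4 : Real.exp (125 / 8) ≤ Real.exp (1 / (32 * X)) := Real.exp_le_exp.2 h1
  rw [Real.exp_neg, inv_eq_one_div, div_le_div_iff_of_pos_left one_pos (Real.exp_pos _) (by norm_num)]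
  linarith

/-- Measurability and boundedness of the translated supersolution integrand `F_U`. [folklore] -/
theorem valleyF_props (hB : 0 < B) (hτ : 0 ≤ 1 / 2 + τ) (U : Cfg) :
    Measurable (fun W : Cfg => Real.exp ((τ - 1 / 2) * B * wilsonAction su2Rep U) *
        (linkE B U (U * W) * Real.exp (-(1 / 2 + τ) * B * wilsonAction su2Rep (U * W))))
      ∧ ∃ C : ℝ, ∀ W : Cfg, |Real.exp ((τ - 1 / 2) * B * wilsonAction su2Rep U) *
        (linkE B U (U * W) * Real.exp (-(1 / 2 + τ) * B * wilsonAction su2Rep (U * W)))| ≤ C := by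
  have hSm : Measurable fun W : Cfg => wilsonAction su2Rep (U * W) :=
    (continuous_wilsonAction su2Rep continuous_su2Rep).measurable.comp (measurable_const.mul measurable_id)
  refine ⟨measurable_const.mul ((measurable_linkE_mul B U).mul (Real.measurable_exp.comp (measurable_const.mul hSm))),
    Real.exp ((τ - 1 / 2) * B * wilsonAction su2Rep U) * (Real.exp (2 * B) ^ Fintype.card (Edge 3 1) * 1), fun W => ?_⟩
  rw [abs_mul, abs_mul, abs_of_nonneg (Real.exp_pos _).le, abs_of_nonneg (linkE_pos B _ _).le, abs_of_nonneg (Real.exp_pos _).le]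
  refine mul_le_mul_of_nonneg_left (mul_le_mul (linkE_le hB.le _ _) ?_ (Real.exp_pos _).le (by positivity)) (Real.exp_pos _).le
  rw [Real.exp_le_one_iff]
  have h1 := wilsonAction_su2_nonneg (U * W)
  have h2 : 0 ≤ (1 / 2 + τ) * B * wilsonAction su2Rep (U * W) := mul_nonneg (mul_nonneg hτ hB.le) h1
  linarith

/-! ### §3. The NEAR supersolution bound -/

set_option maxHeartbeats 400000 in
/-- **THE NEAR SUPERSOLUTION BOUND.**  See the module docstring. [cite: SimonB1983DiscreteSpectrum, §2] [cite: Luscher1983, §2] -/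
theorem valleyJ_le_of_near (hB : 0 < B) (hτ : 0 < 1 / 2 + τ) (U : Cfg) (hρ : 0 < ‖zmCoord 1 U‖) {δ' : ℝ} (hδ'0 : 0 < δ')
    (hδ' : δ' ≤ 1 / 72)
    (hF : ∀ W : Cfg, Real.exp ((τ - 1 / 2) * B * wilsonAction su2Rep U) *
        (linkE B U (U * W) * Real.exp (-(1 / 2 + τ) * B * wilsonAction su2Rep (U * W)))
      ≤ Real.exp (6 * B - B / 2 * ∑ e : Edge 3 1, (2 - 2 * scalarPart (W e))))
    (hε : 9 / 4 * δ' + (1 / 2 + τ) * (2 * Real.sqrt 2 * √(wilsonAction su2Rep U) + 9 * δ' * (2 + 36 * δ')) ≤ 1 / 18)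
    (hgs : 64 * (1 / 2 + τ) ^ 2 * ‖zmCoord 1 U‖ ^ 2 * (B * wilsonAction su2Rep U) ≤ 100) :
    Real.exp ((τ - 1 / 2) * B * wilsonAction su2Rep U) *
        ∫ V, linkE B U V * Real.exp (-(1 / 2 + τ) * B * wilsonAction su2Rep V) ∂(configMeasure SU2 1)
      ≤ (Real.exp (6 * B) * Real.sqrt (π / B) ^ 9 / (2 * π ^ 2) ^ 3) *
        ((1 + 18 * (9 / 4 * δ' + (1 / 2 + τ) * (2 * Real.sqrt 2 * √(wilsonAction su2Rep U) + 9 * δ' * (2 + 36 * δ'))))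
          * Real.exp (B * wilsonAction su2Rep U * (9 * (1 / 2 + τ) ^ 2 * ‖zmCoord 1 U‖ ^ 2 + 18 * δ' * (1 / 2 + τ) - 1))
          * (1 - 5 / 16 * min ((1 / 2 + τ) * (1 - 36 * δ') * ‖zmCoord 1 U‖ ^ 2) (1 / 500))
        + 512 * Real.exp (-(B * δ' / 4))) := by
  -- names
  set S : ℝ := wilsonAction su2Rep U with hSdef
  set ρ : ℝ := ‖zmCoord 1 U‖ with hρdef
  set ε : ℝ := 9 / 4 * δ' + (1 / 2 + τ) * (2 * Real.sqrt 2 * √S + 9 * δ' * (2 + 36 * δ')) with hεdef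
  set 𝒢 : ℝ := Real.exp (6 * B) * Real.sqrt (π / B) ^ 9 / (2 * π ^ 2) ^ 3 with h𝒢
  set F : Cfg → ℝ := fun W => Real.exp ((τ - 1 / 2) * B * S) *
      (linkE B U (U * W) * Real.exp (-(1 / 2 + τ) * B * wilsonAction su2Rep (U * W))) with hFdef
  set Ω : Set Cfg := {W : Cfg | ∑ e : Edge 3 1, (2 - 2 * scalarPart (W e)) ≤ δ'} with hΩ
  have hS0 : 0 ≤ S := wilsonAction_su2_nonneg U
  have hε0 : 0 ≤ ε := by rw [hεdef]; positivity
  have h𝒢0 : 0 < 𝒢 := by rw [h𝒢]; positivity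
  clear_value ε 𝒢
  -- Step 3: the main term
  obtain ⟨g₀, r, hg₀, hr, hg₀n, hΛ⟩ := exists_riesz_near U
  obtain ⟨Λ, hΛdef⟩ : ∃ Λ : ℝ, Λ = ∑ m, ‖r m‖ ^ 2 := ⟨_, rfl⟩
  rw [← hΛdef] at hΛ
  have hΛ0 : 0 < Λ := lt_of_lt_of_le (by positivity) hΛ
  obtain ⟨b, hbdef⟩ : ∃ b : ℝ, b = B * (1 - ε) := ⟨_, rfl⟩
  have hb0 : 0 < b := by rw [hbdef]; exact mul_pos hB (by linarith)
  have hbB : b ≤ B := by rw [hbdef]; nlinarith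
  have hBb : B ≤ b * (18 / 17) := by rw [hbdef]; nlinarith
  obtain ⟨κ₁, hκ₁⟩ : ∃ κ₁ : ℝ, κ₁ = (1 / 2 + τ) * B * (1 - 36 * δ') := ⟨_, rfl⟩
  have hκ₁0 : 0 < κ₁ := by rw [hκ₁]; exact mul_pos (mul_pos hτ hB) (by linarith)
  have hκ₂0 : 0 < 2 * b * (1 / 500) / Λ := div_pos (by linarith) hΛ0
  obtain ⟨κ', hκ'⟩ : ∃ κ' : ℝ, κ' = min κ₁ (2 * b * (1 / 500) / Λ) := ⟨_, rfl⟩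
  have hκ'0 : 0 < κ' := by rw [hκ']; exact lt_min hκ₁0 hκ₂0
  have hκ'1 : κ' ≤ κ₁ := by rw [hκ']; exact min_le_left _ _
  set g : ZM := ((1 / 2 + τ) * B) • g₀ with hgdef
  -- the gain lemma
  obtain ⟨X, hXdef⟩ : ∃ X : ℝ, X = κ' * Λ / (2 * b) := ⟨_, rfl⟩
  have hX0 : 0 < X := by rw [hXdef]; positivity
  have hXle : X ≤ 1 / 500 := by
    rw [hXdef, div_le_iff₀ (by positivity)]
    have : κ' ≤ 2 * b * (1 / 500) / Λ := by rw [hκ']; exact min_le_right _ _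
    have h2 := mul_le_mul_of_nonneg_right this hΛ0.le
    rw [div_mul_cancel₀ _ hΛ0.ne'] at h2
    linarith
  have hXge : min ((1 / 2 + τ) * (1 - 36 * δ') * ρ ^ 2) (1 / 500) ≤ X := by
    rw [hXdef, hκ']
    rcases min_cases κ₁ (2 * b * (1 / 500) / Λ) with ⟨h, _⟩ | ⟨h, _⟩
    · rw [h]
      refine (min_le_left _ _).trans ?_
      rw [le_div_iff₀ (by positivity), hκ₁]
      -- (½+τ)(1−36δ')ρ²·2b ≤ (½+τ)B(1−36δ')Λ
      have h1 : ρ ^ 2 * (2 * b) ≤ B * Λ := by nlinarith [hΛ, hbB, sq_nonneg ρ]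
      have h2 : 0 ≤ (1 / 2 + τ) * (1 - 36 * δ') := mul_nonneg hτ.le (by linarith)
      nlinarith [mul_le_mul_of_nonneg_left h1 h2]
    · rw [h]
      refine (min_le_right _ _).trans (le_of_eq ?_)
      field_simp
  -- ‖g‖² / b ≤ 60
  have hgn : ‖g‖ ^ 2 ≤ (1 / 2 + τ) ^ 2 * B ^ 2 * (32 * ρ ^ 2 * S) := by
    rw [hgdef, norm_smul, Real.norm_eq_abs, abs_of_pos (mul_pos hτ hB), mul_pow, mul_pow]
    refine mul_le_mul_of_nonneg_left ?_ (by positivity)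
    have h0 : 0 ≤ 4 * Real.sqrt 2 * ρ * √S := by positivity
    have := pow_le_pow_left₀ (norm_nonneg _) hg₀n 2
    refine this.trans (le_of_eq ?_)
    rw [mul_pow, mul_pow, mul_pow, Real.sq_sqrt (by norm_num : (0:ℝ) ≤ 2), Real.sq_sqrt hS0]; ring
  have hgb : ‖g‖ ^ 2 / b ≤ 60 := by
    rw [div_le_iff₀ hb0]
    have e1 : (1 / 2 + τ) ^ 2 * B ^ 2 * (32 * ρ ^ 2 * S) = (1 / 2) * ((64 * (1 / 2 + τ) ^ 2 * ρ ^ 2 * (B * S)) * B) := by ring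
    have h1 : (64 * (1 / 2 + τ) ^ 2 * ρ ^ 2 * (B * S)) * B ≤ 100 * B := mul_le_mul_of_nonneg_right hgs hB.le
    linarith [hgn, e1, h1, hBb, hb0]
  have hsmall : κ' * Λ / (2 * b) * (‖g‖ ^ 2 / b) ≤ 1 / 4 := by
    rw [← hXdef]
    have : X * (‖g‖ ^ 2 / b) ≤ 1 / 500 * 60 := mul_le_mul hXle hgb (by positivity) (by norm_num)
    linarith
  have hjunk : Real.sqrt 2 ^ Fintype.card (Fin 3 × Fin 3) * Real.exp (-(1 / (32 * (κ' * Λ / (2 * b)))))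
      * (4 * Fintype.card (Fin 3 × Fin 3) + ‖g‖ ^ 2 / b) ≤ 1 / 2 := by
    rw [← hXdef, show Fintype.card (Fin 3 × Fin 3) = 9 by simp]
    have h1 := exp_junk_le hX0 hXle
    have h2 := sqrt_two_pow_nine_le
    have h3 : (4 * ((9:ℕ):ℝ) + ‖g‖ ^ 2 / b) ≤ 96 := by push_cast; linarith
    have h4 : 0 ≤ 4 * ((9:ℕ):ℝ) + ‖g‖ ^ 2 / b := by positivity
    calc Real.sqrt 2 ^ 9 * Real.exp (-(1 / (32 * X))) * (4 * ((9:ℕ):ℝ) + ‖g‖ ^ 2 / b)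
        ≤ 23 * (1 / 20000) * 96 := by
          refine mul_le_mul (mul_le_mul h2 h1 (Real.exp_pos _).le (by norm_num)) h3 h4 (by positivity)
      _ ≤ 1 / 2 := by norm_num
  -- Step 4: assemble the main term
  have hA : ((2 * π ^ 2)⁻¹) ^ 3 * Real.exp (6 * B - B * S * (1 - 18 * δ' * (1 / 2 + τ)))
      * (Real.exp (‖g‖ ^ 2 / (4 * b)) * Real.sqrt (π / b) ^ 9 * (1 - 5 / 16 * X))
      ≤ 𝒢 * ((1 + 18 * ε) * Real.exp (B * S * (9 * (1 / 2 + τ) ^ 2 * ρ ^ 2 + 18 * δ' * (1 / 2 + τ) - 1))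
          * (1 - 5 / 16 * min ((1 / 2 + τ) * (1 - 36 * δ') * ρ ^ 2) (1 / 500))) := by
    -- √(π/b)⁹ ≤ √(π/B)⁹ (1+18ε)
    have hsq : Real.sqrt (π / b) ^ 9 ≤ Real.sqrt (π / B) ^ 9 * (1 + 18 * ε) := by
      have e1 : Real.sqrt (π / b) = Real.sqrt (π / B) * Real.sqrt (B / b) := by
        rw [← Real.sqrt_mul (by positivity)]; congr 1; field_simp
      rw [e1, mul_pow]
      refine mul_le_mul_of_nonneg_left ?_ (by positivity)
      have hBb1 : 1 ≤ B / b := by rw [le_div_iff₀ hb0]; linarith only [hbB]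
      have hs1 : Real.sqrt (B / b) ≤ B / b := by
        rw [Real.sqrt_le_left (by positivity)]; nlinarith only [hBb1]
      have hBb2 : B / b = 1 / (1 - ε) := by rw [hbdef]; field_simp
      calc Real.sqrt (B / b) ^ 9 ≤ (B / b) ^ 9 := pow_le_pow_left₀ (Real.sqrt_nonneg _) hs1 9
        _ = (1 / (1 - ε)) ^ 9 := by rw [hBb2]
        _ ≤ 1 + 18 * ε := inv_one_sub_pow_nine_le hε0 hε
    -- exponent
    have hexp : Real.exp (6 * B - B * S * (1 - 18 * δ' * (1 / 2 + τ))) * Real.exp (‖g‖ ^ 2 / (4 * b))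
        ≤ Real.exp (6 * B) * Real.exp (B * S * (9 * (1 / 2 + τ) ^ 2 * ρ ^ 2 + 18 * δ' * (1 / 2 + τ) - 1)) := by
      rw [← Real.exp_add, ← Real.exp_add]
      refine Real.exp_le_exp.2 ?_
      have : ‖g‖ ^ 2 / (4 * b) ≤ 9 * (1 / 2 + τ) ^ 2 * ρ ^ 2 * (B * S) := by
        rw [div_le_iff₀ (by positivity)]
        have h1 : (1 / 2 + τ) ^ 2 * B ^ 2 * (32 * ρ ^ 2 * S) = 32 * ((1 / 2 + τ) ^ 2 * ρ ^ 2 * (B * S)) * B := by ring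
        have h2 : 0 ≤ (1 / 2 + τ) ^ 2 * ρ ^ 2 * (B * S) := by positivity
        nlinarith only [hgn, hBb, h1, h2, hb0]
      nlinarith only [this, hS0, hB]
    have hgainle : (1 - 5 / 16 * X) ≤ 1 - 5 / 16 * min ((1 / 2 + τ) * (1 - 36 * δ') * ρ ^ 2) (1 / 500) := by
      linarith only [hXge]
    have hgain0 : 0 ≤ 1 - 5 / 16 * X := by linarith only [hXle]
    have e𝒢 : 𝒢 = ((2 * π ^ 2)⁻¹) ^ 3 * Real.exp (6 * B) * Real.sqrt (π / B) ^ 9 := by rw [h𝒢]; field_simp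
    rw [e𝒢]
    have hπ : 0 < ((2 * π ^ 2)⁻¹) ^ 3 := by positivity
    calc ((2 * π ^ 2)⁻¹) ^ 3 * Real.exp (6 * B - B * S * (1 - 18 * δ' * (1 / 2 + τ)))
          * (Real.exp (‖g‖ ^ 2 / (4 * b)) * Real.sqrt (π / b) ^ 9 * (1 - 5 / 16 * X))
        = ((2 * π ^ 2)⁻¹) ^ 3 * ((Real.exp (6 * B - B * S * (1 - 18 * δ' * (1 / 2 + τ))) * Real.exp (‖g‖ ^ 2 / (4 * b)))
          * (Real.sqrt (π / b) ^ 9 * (1 - 5 / 16 * X))) := by ring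
      _ ≤ ((2 * π ^ 2)⁻¹) ^ 3 * ((Real.exp (6 * B) * Real.exp (B * S * (9 * (1 / 2 + τ) ^ 2 * ρ ^ 2 + 18 * δ' * (1 / 2 + τ) - 1)))
          * (Real.sqrt (π / B) ^ 9 * (1 + 18 * ε) * (1 - 5 / 16 * min ((1 / 2 + τ) * (1 - 36 * δ') * ρ ^ 2) (1 / 500)))) := by
          refine mul_le_mul_of_nonneg_left (mul_le_mul hexp (mul_le_mul hsq hgainle hgain0 (by positivity))
            (by positivity) (by positivity)) hπ.le
      _ = _ := by ring
  -- Step 1: `J = ∫ F`, split along the kinetic ball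
  have hJ : Real.exp ((τ - 1 / 2) * B * S) * ∫ V, linkE B U V * Real.exp (-(1 / 2 + τ) * B * wilsonAction su2Rep V) ∂(configMeasure SU2 1)
      = ∫ W, F W ∂(configMeasure SU2 1) := by
    rw [hFdef, integral_const_mul, integral_comp_mul_left_cfg _ U]
  obtain ⟨hFm, hFb⟩ : Measurable F ∧ ∃ C : ℝ, ∀ W, |F W| ≤ C := valleyF_props hB hτ.le U
  have hΩm : MeasurableSet Ω := measurableSet_le measurable_sumDefect measurable_const
  obtain ⟨C, hC⟩ := hFb
  have hint1 : Integrable (Ω.indicator F) (configMeasure SU2 1) :=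
    integrable_configMeasure_of_bounded (hFm.indicator hΩm) ⟨C, abs_indicator_le hC⟩
  have hint2 : Integrable (Ωᶜ.indicator F) (configMeasure SU2 1) :=
    integrable_configMeasure_of_bounded (hFm.indicator hΩm.compl) ⟨C, abs_indicator_le hC⟩
  have hsplit : ∫ W, F W ∂(configMeasure SU2 1)
      = ∫ W, Ω.indicator F W ∂(configMeasure SU2 1) + ∫ W, Ωᶜ.indicator F W ∂(configMeasure SU2 1) := by
    rw [← integral_add hint1 hint2]
    exact integral_congr_ae (ae_of_all _ fun W => (Set.indicator_self_add_compl_apply Ω F W).symm)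
  rw [hJ, hsplit]
  -- Step 2: the tail
  have htail := near_tail_le (δ' := δ') hB hFm ⟨C, hC⟩ hF
  rw [← h𝒢] at htail
  have hb' : 0 < B * (1 - 9 / 4 * δ' - (1 / 2 + τ) * (2 * Real.sqrt 2 * √S + 9 * δ' * (2 + 36 * δ'))) := by
    convert hb0 using 1; rw [hbdef, hεdef]; ring
  have hmain := near_main_le hB hτ.le U hδ'0.le (by linarith) g₀ r hg₀ hr hκ'0.le (hκ'1.trans (le_of_eq hκ₁)) hb'
  have eb : B * (1 - 9 / 4 * δ' - (1 / 2 + τ) * (2 * Real.sqrt 2 * √S + 9 * δ' * (2 + 36 * δ'))) = b := by rw [hbdef, hεdef]; ring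
  rw [eb] at hmain
  have hΛ0' : 0 < ∑ m, ‖r m‖ ^ 2 := by rw [← hΛdef]; exact hΛ0
  have hsmall' : κ' * (∑ m, ‖r m‖ ^ 2) / (2 * b) * (‖g‖ ^ 2 / b) ≤ 1 / 4 := by rw [← hΛdef]; exact hsmall
  have hjunk' : Real.sqrt 2 ^ Fintype.card (Fin 3 × Fin 3) * Real.exp (-(1 / (32 * (κ' * (∑ m, ‖r m‖ ^ 2) / (2 * b)))))
      * (4 * Fintype.card (Fin 3 × Fin 3) + ‖g‖ ^ 2 / b) ≤ 1 / 2 := by rw [← hΛdef]; exact hjunk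
  have hgain := GaussNear.integral_gaussGain_le (ι := Fin 3 × Fin 3) hb0 hκ'0 r g hΛ0' hsmall' hjunk'
  rw [← hΛdef, ← hXdef, show Fintype.card (Fin 3 × Fin 3) = 9 by simp] at hgain
  -- Step 5: combine
  have hmain' : ∫ W, Ω.indicator F W ∂(configMeasure SU2 1)
      ≤ 𝒢 * ((1 + 18 * ε) * Real.exp (B * S * (9 * (1 / 2 + τ) ^ 2 * ρ ^ 2 + 18 * δ' * (1 / 2 + τ) - 1))
          * (1 - 5 / 16 * min ((1 / 2 + τ) * (1 - 36 * δ') * ρ ^ 2) (1 / 500))) := by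
    refine hmain.trans (le_trans ?_ hA)
    exact mul_le_mul_of_nonneg_left hgain (by positivity)
  calc ∫ W, Ω.indicator F W ∂(configMeasure SU2 1) + ∫ W, Ωᶜ.indicator F W ∂(configMeasure SU2 1)
      ≤ 𝒢 * ((1 + 18 * ε) * Real.exp (B * S * (9 * (1 / 2 + τ) ^ 2 * ρ ^ 2 + 18 * δ' * (1 / 2 + τ) - 1))
          * (1 - 5 / 16 * min ((1 / 2 + τ) * (1 - 36 * δ') * ρ ^ 2) (1 / 500))) + 512 * Real.exp (-(B * δ' / 4)) * 𝒢 :=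
        add_le_add hmain' htail
    _ = _ := by ring

end Summit.QuantumFields.YangMills.Theorems.FemtoTransferGap

end
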